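import Summits.Ventures.CertifiedManyBodySolver.Downfold.EmeryAxialSlabBi2201Windows
import Summits.Ventures.CertifiedManyBodySolver.Downfold.EmeryFermiFillingBi2201
import Summits.Ventures.CertifiedManyBodySolver.Downfold.EmeryFermiFillingLa214
import Summits.Ventures.CertifiedManyBodySolver.Downfold.EmeryAxialConductionBand
import HarnessLib

/-!
# Bi₂Sr₂CuO₆₊δ (box #61 Bi-2201, Morée 2022 source rows): the axial co-shift census ON THE TYPED BOX `emeryBoxBi2201M61MoreePPSrc` — verdicts against the object-E row
# `t′/t ∈ [-0.411, -0.31]` and their FOUR-ORBITAL reading (companion of `EmeryAxialSlabBi2201Windows`, which carries the method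
# docstring, the slab table and the raw slab windows; the kernel certificates are in `EmeryAxialSlabBi2201Subs*`)

Venture CertifiedManyBodySolver, cell `pub/hubbard-downfold` (stage S1), seat hubbard-downfold-mod-4 (technique B); namespace
`Summit.Ventures.CertifiedManyBodySolver.Downfold.Emery`. Everything PROVED. READING (certified): every slab MEETS the E row (no exclusion certified at this resolution).
WHAT THIS IS NOT: not a statement that the material's parameters ARE in the box (SCREENING-GRADE provenance); `U = 0` band kinematics; no phase
sentence; the E row is a [float] literature refit; `a_F` is the ADDITIONAL admixture beyond the box's σ rows (a model-form distance).
Sources: [AndersenEtAl1995, §§5–6]; [PavariniEtAl2001, Eqs. (1)–(3), Fig. 3]; [HybertsenSchluterChristensen1989, Eq. (1)].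
-/

noncomputable section

namespace Summit.Ventures.CertifiedManyBodySolver.Downfold.Emery

open Real Set
open Summit.Ventures.CertifiedManyBodySolver.Downfold

/-! ## §2 The typed box and the co-shift as a parameter -/

/-- The one-body rows and the per-spin filling of `emeryBoxBi2201M61MoreePPSrc` read by this file. [folklore] -/
theorem emeryBoxBi2201M61MoreePPSrc_axRows {p : EmeryCoord → ℝ} (hp : emeryBoxBi2201M61MoreePPSrc.Mem p) :
    p .DeltaPd ∈ Set.Icc (44 / 25 : ℝ) (59 / 25 : ℝ) ∧ p .tpd ∈ Set.Icc (5 / 4 : ℝ) (147 / 100 : ℝ) ∧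
      p .tpp ∈ Set.Icc (31 / 50 : ℝ) (37 / 50 : ℝ) ∧ p .tppP ∈ Set.Icc (7 / 50 : ℝ) (17 / 100 : ℝ) ∧
      (2 - p .nHoles) / 2 ∈ Set.Icc (103 / 250 : ℝ) (107 / 250 : ℝ) := by
  obtain ⟨hΔ, ha, hb, hc, hn⟩ := emeryBoxBi2201M61MoreePPSrc_mem_rows hp
  exact ⟨hΔ, ha, hb, hc, abFilling_rowBi2201_of_nHoles hn.1 hn.2 rfl⟩

/-- **Slab 0 on the typed box**: for every parameter vector of `emeryBoxBi2201M61MoreePPSrc`, every co-shift `a ∈ [0, 0.1]` and every Fermi energy at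
which the CO-SHIFTED σ antibonding band holds the box's electrons: `ε ∈ [1.24, 2.38]`, `t′/t ∈ [-0.3597, -0.2443]` (MEETS).
[folklore] -/
theorem emeryBoxBi2201M61MoreePPSrc_axSlab0 :
    HoldsOn (fun p : EmeryCoord → ℝ => ∀ a ε : ℝ, a ∈ Set.Icc (0 : ℝ) (1 / 10 : ℝ) →
      abFilling (p .DeltaPd) (p .tpd) (p .tpp + a) (p .tppP + a) ε = (2 - p .nHoles) / 2 →
      ε ∈ Set.Icc (31 / 25 : ℝ) (119 / 50 : ℝ) ∧
      fsRatio (p .DeltaPd) (p .tpd) (p .tpp + a) (p .tppP + a) ε ∈ Set.Icc (-(3597 / 10000 : ℝ)) (-(2443 / 10000 : ℝ))) emeryBoxBi2201M61MoreePPSrc := by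
  intro p hp a ε ha' hf
  obtain ⟨hΔ, ha, hb, hc, hν⟩ := emeryBoxBi2201M61MoreePPSrc_axRows hp
  rw [← hf] at hν
  exact bi2201AxSlab0_window hΔ ha ⟨by linarith [hb.1, ha'.1], by linarith [hb.2, ha'.2]⟩
    ⟨by linarith [hc.1, ha'.1], by linarith [hc.2, ha'.2]⟩ hν

/-- **Slab 1 on the typed box**: for every parameter vector of `emeryBoxBi2201M61MoreePPSrc`, every co-shift `a ∈ [0.1, 0.2]` and every Fermi energy at
which the CO-SHIFTED σ antibonding band holds the box's electrons: `ε ∈ [1.2, 2.32]`, `t′/t ∈ [-0.3956, -0.2887]` (MEETS).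
[folklore] -/
theorem emeryBoxBi2201M61MoreePPSrc_axSlab1 :
    HoldsOn (fun p : EmeryCoord → ℝ => ∀ a ε : ℝ, a ∈ Set.Icc (1 / 10 : ℝ) (1 / 5 : ℝ) →
      abFilling (p .DeltaPd) (p .tpd) (p .tpp + a) (p .tppP + a) ε = (2 - p .nHoles) / 2 →
      ε ∈ Set.Icc (6 / 5 : ℝ) (58 / 25 : ℝ) ∧
      fsRatio (p .DeltaPd) (p .tpd) (p .tpp + a) (p .tppP + a) ε ∈ Set.Icc (-(989 / 2500 : ℝ)) (-(2887 / 10000 : ℝ))) emeryBoxBi2201M61MoreePPSrc := by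
  intro p hp a ε ha' hf
  obtain ⟨hΔ, ha, hb, hc, hν⟩ := emeryBoxBi2201M61MoreePPSrc_axRows hp
  rw [← hf] at hν
  exact bi2201AxSlab1_window hΔ ha ⟨by linarith [hb.1, ha'.1], by linarith [hb.2, ha'.2]⟩
    ⟨by linarith [hc.1, ha'.1], by linarith [hc.2, ha'.2]⟩ hν

/-- **Slab 2 on the typed box**: for every parameter vector of `emeryBoxBi2201M61MoreePPSrc`, every co-shift `a ∈ [0.2, 0.3]` and every Fermi energy at
which the CO-SHIFTED σ antibonding band holds the box's electrons: `ε ∈ [1.16, 2.24]`, `t′/t ∈ [-0.4265, -0.3214]` (MEETS).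
[folklore] -/
theorem emeryBoxBi2201M61MoreePPSrc_axSlab2 :
    HoldsOn (fun p : EmeryCoord → ℝ => ∀ a ε : ℝ, a ∈ Set.Icc (1 / 5 : ℝ) (3 / 10 : ℝ) →
      abFilling (p .DeltaPd) (p .tpd) (p .tpp + a) (p .tppP + a) ε = (2 - p .nHoles) / 2 →
      ε ∈ Set.Icc (29 / 25 : ℝ) (56 / 25 : ℝ) ∧
      fsRatio (p .DeltaPd) (p .tpd) (p .tpp + a) (p .tppP + a) ε ∈ Set.Icc (-(853 / 2000 : ℝ)) (-(1607 / 5000 : ℝ))) emeryBoxBi2201M61MoreePPSrc := by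
  intro p hp a ε ha' hf
  obtain ⟨hΔ, ha, hb, hc, hν⟩ := emeryBoxBi2201M61MoreePPSrc_axRows hp
  rw [← hf] at hν
  exact bi2201AxSlab2_window hΔ ha ⟨by linarith [hb.1, ha'.1], by linarith [hb.2, ha'.2]⟩
    ⟨by linarith [hc.1, ha'.1], by linarith [hc.2, ha'.2]⟩ hν

/-- **Slab 3 on the typed box**: for every parameter vector of `emeryBoxBi2201M61MoreePPSrc`, every co-shift `a ∈ [0.3, 0.4]` and every Fermi energy at
which the CO-SHIFTED σ antibonding band holds the box's electrons: `ε ∈ [1.14, 2.24]`, `t′/t ∈ [-0.4526, -0.3476]` (MEETS).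
[folklore] -/
theorem emeryBoxBi2201M61MoreePPSrc_axSlab3 :
    HoldsOn (fun p : EmeryCoord → ℝ => ∀ a ε : ℝ, a ∈ Set.Icc (3 / 10 : ℝ) (2 / 5 : ℝ) →
      abFilling (p .DeltaPd) (p .tpd) (p .tpp + a) (p .tppP + a) ε = (2 - p .nHoles) / 2 →
      ε ∈ Set.Icc (57 / 50 : ℝ) (56 / 25 : ℝ) ∧
      fsRatio (p .DeltaPd) (p .tpd) (p .tpp + a) (p .tppP + a) ε ∈ Set.Icc (-(2263 / 5000 : ℝ)) (-(869 / 2500 : ℝ))) emeryBoxBi2201M61MoreePPSrc := by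
  intro p hp a ε ha' hf
  obtain ⟨hΔ, ha, hb, hc, hν⟩ := emeryBoxBi2201M61MoreePPSrc_axRows hp
  rw [← hf] at hν
  exact bi2201AxSlab3_window hΔ ha ⟨by linarith [hb.1, ha'.1], by linarith [hb.2, ha'.2]⟩
    ⟨by linarith [hc.1, ha'.1], by linarith [hc.2, ha'.2]⟩ hν

/-- **Slab 4 on the typed box**: for every parameter vector of `emeryBoxBi2201M61MoreePPSrc`, every co-shift `a ∈ [0.4, 0.5]` and every Fermi energy at
which the CO-SHIFTED σ antibonding band holds the box's electrons: `ε ∈ [1.1, 2.18]`, `t′/t ∈ [-0.4733, -0.3698]` (MEETS).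
[folklore] -/
theorem emeryBoxBi2201M61MoreePPSrc_axSlab4 :
    HoldsOn (fun p : EmeryCoord → ℝ => ∀ a ε : ℝ, a ∈ Set.Icc (2 / 5 : ℝ) (1 / 2 : ℝ) →
      abFilling (p .DeltaPd) (p .tpd) (p .tpp + a) (p .tppP + a) ε = (2 - p .nHoles) / 2 →
      ε ∈ Set.Icc (11 / 10 : ℝ) (109 / 50 : ℝ) ∧
      fsRatio (p .DeltaPd) (p .tpd) (p .tpp + a) (p .tppP + a) ε ∈ Set.Icc (-(4733 / 10000 : ℝ)) (-(1849 / 5000 : ℝ))) emeryBoxBi2201M61MoreePPSrc := by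
  intro p hp a ε ha' hf
  obtain ⟨hΔ, ha, hb, hc, hν⟩ := emeryBoxBi2201M61MoreePPSrc_axRows hp
  rw [← hf] at hν
  exact bi2201AxSlab4_window hΔ ha ⟨by linarith [hb.1, ha'.1], by linarith [hb.2, ha'.2]⟩
    ⟨by linarith [hc.1, ha'.1], by linarith [hc.2, ha'.2]⟩ hν

/-- **Slab 5 on the typed box**: for every parameter vector of `emeryBoxBi2201M61MoreePPSrc`, every co-shift `a ∈ [0.5, 0.6]` and every Fermi energy at
which the CO-SHIFTED σ antibonding band holds the box's electrons: `ε ∈ [1.08, 2.12]`, `t′/t ∈ [-0.4931, -0.3881]` (MEETS).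
[folklore] -/
theorem emeryBoxBi2201M61MoreePPSrc_axSlab5 :
    HoldsOn (fun p : EmeryCoord → ℝ => ∀ a ε : ℝ, a ∈ Set.Icc (1 / 2 : ℝ) (3 / 5 : ℝ) →
      abFilling (p .DeltaPd) (p .tpd) (p .tpp + a) (p .tppP + a) ε = (2 - p .nHoles) / 2 →
      ε ∈ Set.Icc (27 / 25 : ℝ) (53 / 25 : ℝ) ∧
      fsRatio (p .DeltaPd) (p .tpd) (p .tpp + a) (p .tppP + a) ε ∈ Set.Icc (-(4931 / 10000 : ℝ)) (-(3881 / 10000 : ℝ))) emeryBoxBi2201M61MoreePPSrc := by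
  intro p hp a ε ha' hf
  obtain ⟨hΔ, ha, hb, hc, hν⟩ := emeryBoxBi2201M61MoreePPSrc_axRows hp
  rw [← hf] at hν
  exact bi2201AxSlab5_window hΔ ha ⟨by linarith [hb.1, ha'.1], by linarith [hb.2, ha'.2]⟩
    ⟨by linarith [hc.1, ha'.1], by linarith [hc.2, ha'.2]⟩ hν

/-! ## §3 The census verdicts against the E row -/

/-! ## §4 The four-orbital reading (transfer theorem `EmeryAxialConductionBand.condFilling_eq_abFilling`) -/

end Summit.Ventures.CertifiedManyBodySolver.Downfold.Emery
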